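import Summits.QuantumFields.YangMills.Theorems.AlphaInputsT3ACv3TubeProfile
import Summits.QuantumFields.YangMills.Theorems.AlphaInputsT3ACv3TubeFieldModel
import HarnessLib

/-!
# `AlphaInputsT3ACv3TubeProfileBox` — (S1) IN THE CARRIERS OF RECORD: the universal tube profile `β_r` of `…TubeProfile` as a MODEL 1-FORM `betaB μ ν r : (Fin d → ℤ) → Fin d → ℝ` on
# `ℤ^d` (transverse to the edge `{u_μ = u_ν = ½}`-direction pair `(μ, ν)`, longitudinally constant), with ★ `curlB (betaB μ ν r) u μ ν = δ₀(u_μ)δ₀(u_ν) − ρ_r(u_μ, u_ν)`, longitudinal curls `0`,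
# and ★★ `curlB (stringInd μ ν + betaB μ ν r) u μ ν = −ρ_r(u_μ, u_ν)` — the form `t := s + β_r` the LEAD's `TubeStart.tubeU` consumes (row (S2)) — cell `ym3-torus`, width seat `ym-ust-19936-w2` (g2)

WHY (★w1-19936 g2 LEAD 02:30:00Z: «please state `curl_beta` ALSO in `ModelBox.curlB` letters so (S2) consumes it by name»).  `…TubeProfile` is Mathlib-only (scalar letters on `ℤ²`);
`…TubeFieldModel` (LEAD, (S2)) reads ANY transverse real form `t : (Fin d → ℤ) → Fin d → ℝ` and shows `plaqB (tubeU t) = G⁻¹·expSU(curlB t · F′)·G` exactly.  This file is the 3-line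
bridge, d-generic: `betaB μ ν r u κ := β_X(u_μ, u_ν)` for `κ = μ`, `β_Y(u_μ, u_ν)` for `κ = ν`, `0` otherwise.  SIGN: the LEAD's string has `curlB s = −δ_corner` (`TubeStart.curlB_stringInd`),
my profile has `curl β_r = +δ_corner − ρ_r` (`TubeProfile.curl_beta`), so the tube form is `t = s + β_r` (the memo's `s − β` with `β ↦ −β_r`): `curlB t = −ρ_r` on transverse plaquettes.
WHAT.  `betaB` (def), `betaB_apply_fst/_snd/_of_ne`, `betaB_add_e_of_ne` (longitudinal invariance), ★ `curlB_betaB`, `curlB_betaB_longitudinal` (both orientations `0`), ★★ `curlB_stringInd_add_betaB`,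
`curlB_stringInd_add_betaB_longitudinal`, bounds `abs_betaB_fst_le` (`≤ 1/(2r+1)`), `abs_betaB_le` (`≤ 1`), `abs_curlB_stringInd_add_betaB_le` (`≤ 1/(2r+1)²`), support `betaB_eq_zero_of_fst`∕`_of_snd`
(`β_r = 0` once `|u_μ| > r` or `u_ν ∉ (−r, r]`·… as printed), and the plaquette reading ★ `dist1_plaqB_tubeU_stringInd_add_betaB_le`: every transverse plaquette of `tubeU (s + β_r)` is within
`exp(‖F′‖/(2r+1)²) − 1` of `1`, every longitudinal one IS `1`.
HONEST FRAMING.  Bookkeeping over two accepted files; count-neutral helper toward the (FL) row of 2′∕2′χ (`--supports stmt-QuantumFields-19936`); (S2)–(S6), (FL)∕`hLift`, the stub, the crux and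
the gap are NOT claimed; registry untouched.  YM₃ on the three-torus is RUNG R3 of the programme, not the Clay problem.

References: T. Bałaban, Commun. Math. Phys. 102 (1985) 277–309 [Balaban1985Variational] ((11)–(14) pp.279–280); Commun. Math. Phys. 98 (1985) 17–51 [Balaban1985Averaging] ((8)–(9) p.18).
-/

set_option autoImplicit false

noncomputable section

open scoped Matrix.Norms.L2Operator

namespace Summit.QuantumFields.YangMills.Theorems.TubeProfile

open Literature.MathematicalPhysics.QuantumFieldTheory.Balaban1983to89
open Literature.MathematicalPhysics.QuantumFieldTheory.Balaban1983to89.T4AdjointCovarianceUnitary (lieSU)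
open Summit.QuantumFields.YangMills.Theorems.ModelBox
open Summit.QuantumFields.YangMills.Theorems.TubeStart (stringInd tubeU curlB_stringInd stringInd_of_ne stringInd_add_e_of_ne curlB_eq_zero_of_longitudinal dist1_plaqB_tubeU_le
  plaqB_tubeU_eq_one)

variable {d : ℕ} (μ ν : Fin d) (r : ℕ)

/-! ## §1 The profile as a model 1-form -/

/-- **THE TUBE PROFILE AS A MODEL 1-FORM**: `β_r(u, μ) = β_X(u_μ, u_ν)`, `β_r(u, ν) = β_Y(u_μ, u_ν)`, `0` on every other bond direction. [folklore] -/
def betaB (u : Fin d → ℤ) (κ : Fin d) : ℝ :=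
  if κ = μ then betaX r (u μ) (u ν) else if κ = ν then betaY r (u μ) (u ν) else 0

/-- On `μ`-bonds `β_r = β_X`. [folklore] -/
theorem betaB_apply_fst (u : Fin d → ℤ) : betaB μ ν r u μ = betaX r (u μ) (u ν) := by simp [betaB]

/-- On `ν`-bonds (`ν ≠ μ`) `β_r = β_Y`. [folklore] -/
theorem betaB_apply_snd (hμν : μ ≠ ν) (u : Fin d → ℤ) : betaB μ ν r u ν = betaY r (u μ) (u ν) := by
  simp [betaB, hμν.symm]

/-- On longitudinal bonds `β_r = 0`. [folklore] -/
theorem betaB_of_ne {κ : Fin d} (hκμ : κ ≠ μ) (hκν : κ ≠ ν) (u : Fin d → ℤ) : betaB μ ν r u κ = 0 := by simp [betaB, hκμ, hκν]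

/-- `β_r` is invariant under longitudinal translations. [folklore] -/
theorem betaB_add_e_of_ne {κ : Fin d} (hκμ : κ ≠ μ) (hκν : κ ≠ ν) (u : Fin d → ℤ) (α : Fin d) : betaB μ ν r (u + e κ) α = betaB μ ν r u α := by
  simp only [betaB, add_e_apply_ne _ hκμ.symm, add_e_apply_ne _ hκν.symm]

/-- **★ THE CURL OF THE PROFILE ON TRANSVERSE PLAQUETTES**: `curlB β_r (u; μ, ν) = δ₀(u_μ)δ₀(u_ν) − ρ_r(u_μ, u_ν)` (`TubeProfile.curl_beta` in `ModelBox.curlB` letters). [folklore] -/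
theorem curlB_betaB (hμν : μ ≠ ν) (u : Fin d → ℤ) : curlB (betaB μ ν r) u μ ν = delta0 (u μ) * delta0 (u ν) - rho r (u μ) (u ν) := by
  rw [curlB_def, betaB_apply_fst, betaB_apply_fst, betaB_apply_snd μ ν r hμν, betaB_apply_snd μ ν r hμν, add_e_apply_same, add_e_apply_ne _ hμν,
    add_e_apply_ne _ (Ne.symm hμν), add_e_apply_same]
  exact curl_beta r (u μ) (u ν)

/-- Longitudinal plaquettes see no curl of `β_r` (both orientations). [folklore] -/
theorem curlB_betaB_longitudinal {κ : Fin d} (hκμ : κ ≠ μ) (hκν : κ ≠ ν) (u : Fin d → ℤ) (α : Fin d) :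
    curlB (betaB μ ν r) u α κ = 0 ∧ curlB (betaB μ ν r) u κ α = 0 :=
  curlB_eq_zero_of_longitudinal _ κ (fun v => betaB_of_ne μ ν r hκμ hκν v) (fun v β => betaB_add_e_of_ne μ ν r hκμ hκν v β) u α

/-! ## §2 The tube form `t = s + β_r` -/

/-- **★★ THE TUBE FORM SPREADS THE CORNER**: `curlB (s + β_r) (u; μ, ν) = −ρ_r(u_μ, u_ν)` — the string's `−δ_corner` plus the profile's `δ_corner − ρ_r`. [folklore] -/
theorem curlB_stringInd_add_betaB (hμν : μ ≠ ν) (u : Fin d → ℤ) : curlB (stringInd μ ν + betaB μ ν r) u μ ν = -rho r (u μ) (u ν) := by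
  rw [curlB_add, curlB_stringInd μ ν hμν, curlB_betaB μ ν r hμν]
  unfold delta0
  by_cases h0 : u μ = 0
  · by_cases h1 : u ν = 0
    · rw [if_pos ⟨h0, h1⟩, if_pos h0, if_pos h1]; ring
    · rw [if_neg (fun h => h1 h.2), if_pos h0, if_neg h1]; ring
  · rw [if_neg (fun h => h0 h.1), if_neg h0]; ring

/-- Longitudinal plaquettes see no curl of `s + β_r` either. [folklore] -/
theorem curlB_stringInd_add_betaB_longitudinal (hμν : μ ≠ ν) {κ : Fin d} (hκμ : κ ≠ μ) (hκν : κ ≠ ν) (u : Fin d → ℤ) (α : Fin d) :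
    curlB (stringInd μ ν + betaB μ ν r) u α κ = 0 ∧ curlB (stringInd μ ν + betaB μ ν r) u κ α = 0 := by
  have hs := curlB_eq_zero_of_longitudinal (stringInd μ ν) κ (fun v => stringInd_of_ne μ ν hκμ v) (fun v β => stringInd_add_e_of_ne μ ν hκμ hκν v β) u α
  have hb := curlB_betaB_longitudinal μ ν r hκμ hκν u α
  have _ := hμν
  refine ⟨?_, ?_⟩
  · rw [curlB_add, hs.1, hb.1, add_zero]
  · rw [curlB_add, hs.2, hb.2, add_zero]

/-! ## §3 Sizes and support -/

/-- `|β_r(u, μ)| ≤ 1/(2r+1)`. [folklore] -/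
theorem abs_betaB_fst_le (u : Fin d → ℤ) : |betaB μ ν r u μ| ≤ ((2 * (r : ℝ) + 1))⁻¹ := by
  rw [betaB_apply_fst]; exact abs_betaX_le r _ _

/-- `|β_r(u, κ)| ≤ 1` on every bond. [folklore] -/
theorem abs_betaB_le (u : Fin d → ℤ) (κ : Fin d) : |betaB μ ν r u κ| ≤ 1 := by
  unfold betaB
  split_ifs
  · exact (abs_betaX_le r _ _).trans (inv_le_one_of_one_le₀ (by linarith [Nat.cast_nonneg (α := ℝ) r]))
  · exact abs_betaY_le r _ _
  · simp

/-- `|curlB (s + β_r) (u; μ, ν)| ≤ 1/(2r+1)²`. [folklore] -/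
theorem abs_curlB_stringInd_add_betaB_le (hμν : μ ≠ ν) (u : Fin d → ℤ) : |curlB (stringInd μ ν + betaB μ ν r) u μ ν| ≤ ((2 * (r : ℝ) + 1))⁻¹ ^ 2 := by
  rw [curlB_stringInd_add_betaB μ ν r hμν, abs_neg, abs_of_nonneg (rho_nonneg r _ _)]
  exact rho_le r _ _

/-- `β_r(u, ·) = 0` off the transverse window in `u_μ` (`u_μ < −r` or `r < u_μ`). [folklore] -/
theorem betaB_eq_zero_of_fst {u : Fin d → ℤ} (h : u μ < -(r : ℤ) ∨ (r : ℤ) < u μ) (κ : Fin d) : betaB μ ν r u κ = 0 := by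
  unfold betaB
  split_ifs
  · exact betaX_eq_zero r (by omega)
  · exact betaY_eq_zero r (by omega)
  · rfl

/-- `β_r(u, ·) = 0` off the transverse window in `u_ν` (`u_ν ≤ −r` or `r < u_ν`; note `β_Y` lives on `u_ν = 0` only). [folklore] -/
theorem betaB_eq_zero_of_snd {u : Fin d → ℤ} (h : u ν ≤ -(r : ℤ) ∨ (r : ℤ) < u ν) (hr : 0 < r) (κ : Fin d) : betaB μ ν r u κ = 0 := by
  unfold betaB
  split_ifs
  · exact betaX_eq_zero r (by omega)
  · exact betaY_eq_zero r (by omega)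
  · rfl

/-! ## §4 The plaquettes of the tube field `U_{s + β_r}` -/

section Tube

variable {n : Type*} [Fintype n] [DecidableEq n] [Nonempty n] (V₁₂ V₂₃ V₁₄ : Matrix.specialUnitaryGroup n ℂ) (F' : lieSU n)

/-- **★ THE TUBE FIELD'S TRANSVERSE PLAQUETTES ARE UNIFORMLY SMALL**: `dist1 (plaqB U_{s+β_r} (u; μ, ν)) ≤ exp(‖F′‖/(2r+1)²) − 1` (LEAD's `dist1_plaqB_tubeU_le` with `|curlB t| ≤ 1/(2r+1)²`).
[cite: Balaban1985Averaging, (8) p.18] -/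
theorem dist1_plaqB_tubeU_stringInd_add_betaB_le (hμν : μ ≠ ν) (u : Fin d → ℤ) :
    GaugeGroup.dist1 (plaqB (tubeU μ ν V₁₂ V₂₃ V₁₄ F' (stringInd μ ν + betaB μ ν r)) u μ ν) ≤ Real.exp (((2 * (r : ℝ) + 1))⁻¹ ^ 2 * ‖(F' : Matrix n n ℂ)‖) - 1 := by
  refine (dist1_plaqB_tubeU_le μ ν V₁₂ V₂₃ V₁₄ F' _ u μ ν).trans ?_
  gcongr
  exact abs_curlB_stringInd_add_betaB_le μ ν r hμν u

omit [Nonempty n] in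
/-- Longitudinal plaquettes of the tube field ARE `1` (`κ ∉ {μ, ν}`, either slot). [cite: Balaban1985Averaging, (8) p.18] -/
theorem plaqB_tubeU_stringInd_add_betaB_eq_one (hμν : μ ≠ ν) {κ : Fin d} (hκμ : κ ≠ μ) (hκν : κ ≠ ν) (u : Fin d → ℤ) (α : Fin d) :
    plaqB (tubeU μ ν V₁₂ V₂₃ V₁₄ F' (stringInd μ ν + betaB μ ν r)) u α κ = 1 ∧ plaqB (tubeU μ ν V₁₂ V₂₃ V₁₄ F' (stringInd μ ν + betaB μ ν r)) u κ α = 1 := by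
  have h := curlB_stringInd_add_betaB_longitudinal μ ν r hμν hκμ hκν u α
  exact ⟨plaqB_tubeU_eq_one μ ν V₁₂ V₂₃ V₁₄ F' _ u α κ h.1, plaqB_tubeU_eq_one μ ν V₁₂ V₂₃ V₁₄ F' _ u κ α h.2⟩

end Tube

end Summit.QuantumFields.YangMills.Theorems.TubeProfile

end
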